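import Literature.NumberTheory.Automorphic.QuaternionLocalUnitDensity
import Mathlib.Topology.Algebra.InfiniteSum.Real
import Mathlib.Analysis.SpecificLimits.Basic
import HarnessLib

/-!
# The local Euler factor of an order from the unit density:
# `∑_k a(p^k) p^{-2k} = p⁴ / |O₍ₚ₎ˣ mod p|`

Topic `NumberTheory/Automorphic`; theorems only (no definition, no named fact, no instance).
The generic step of the unit-index form of Eichler's mass formula (Voight, *Quaternion
Algebras*, §26.4, Lemma 26.6.7; Körner 1987 §3): for a `ℤ`-order `O` of a definite quaternion
algebra over `ℚ` and a prime `p`, write `Λ = O₍ₚ₎`, `G = Λˣ`, `a_k` for the number of principal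
right ideals `z Λ` (`z ∈ Λ`) of index `p^{2k}`, `X_k` for the set of their generators and
`Y_R = Λ ∖ ⋃_{k<R} X_k`. The identities of `QuaternionLocalUnitDensity.lean`,

  `p^{2k} |X_k mod p^R| = a_k |G mod p^R|` (`k < R`),  `|G mod p^R| = p^{4(R-1)} |G mod p|`,
  `p^{4R} = ∑_{k<R} |X_k mod p^R| + |Y_R mod p^R|`,

give `∑_{k<R} a_k p^{-2k} = (p⁴ / |G mod p|) · (1 - |Y_R mod p^R| / p^{4R})`
(`sum_range_card_principal_div_eq`); hence, **if the density `|Y_R mod p^R| / p^{4R}` of the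
norm-level complement tends to `0`**, the local factor `∑_k a_k p^{-2k}` of the zeta function of
`O` at `p` converges to `p⁴ / |G mod p|` (`hasSum_card_principal_div_pow`). The two
model-dependent inputs — the unit count `|G mod p| = |(O/pO)ˣ|` and the density decay — are
supplied per prime elsewhere (ramified: `QuaternionLocalRamifiedStructure.lean`; Eichler at a
split prime: the Eichler model files).

## References

* J. Voight, *Quaternion Algebras*, GTM 288 (2021), §26.4, Prop. 26.6.4, Lemma 26.6.7
  [Voight2021].
* O. Körner, Proc. Indian Acad. Sci. 97 (1987), §3.
* M.-F. Vignéras, LNM 800 (1980), Ch. V §2 (formule des masses) [VignerasLNM800].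
-/

noncomputable section

open scoped Pointwise Topology BigOperators
open Filter Finset

universe u

namespace Literature.NumberTheory.Automorphic

variable {B : Type u} [Ring B] [Algebra ℚ B] [IsQuaternionAlgebra ℚ B]
variable {p : ℕ} [hp : Fact p.Prime] {O : Submodule ℤ B} (hO : IsZOrder O)
include hO

/-- The image of the unit group `G = O₍ₚ₎ˣ` modulo `p O₍ₚ₎` is non-empty (it contains `1`), so
`|G mod p| ≥ 1`. [folklore] -/
theorem IsZOrder.ncard_image_stabilizer_pos :
    0 < (QuotientAddGroup.mk '' (Units.val '' (MulAction.stabilizer Bˣ (localAt p O) : Set Bˣ)) :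
      Set (B ⧸ (((p : ℤ) ^ 1) • localAt p O).toAddSubgroup)).ncard := by
  classical
  have hfin : (QuotientAddGroup.mk '' (Units.val '' (MulAction.stabilizer Bˣ (localAt p O) : Set Bˣ)) :
      Set (B ⧸ (((p : ℤ) ^ 1) • localAt p O).toAddSubgroup)).Finite := by
    refine (hO.finite_image_mk_localAt 1).subset (Set.image_mono ?_)
    rintro _ ⟨u, hu, rfl⟩
    exact (hO.mem_stabilizer_localAt_iff.mp hu).1
  rw [Set.ncard_pos hfin]
  refine ⟨QuotientAddGroup.mk 1, 1, ⟨1, ?_, rfl⟩, rfl⟩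
  exact (MulAction.stabilizer Bˣ (localAt p O)).one_mem

/-- **Partial sums of the local factor from the unit density**: for every `R ≥ 1`,
`∑_{k<R} a_k p^{-2k} = (p⁴ / |G mod p|) (1 - |Y_R mod p^R| / p^{4R})`, where `a_k` is the number
of principal right ideals of `O₍ₚ₎` of index `p^{2k}`, `G = O₍ₚ₎ˣ` and `Y_R` the complement in
`O₍ₚ₎` of the norm levels `X_k`, `k < R`. [cite: Voight2021, Lemma 26.6.7 and §26.4] -/
theorem IsZOrder.sum_range_card_principal_div_eq {R : ℕ} (hR : 1 ≤ R) :
    ∑ k ∈ range R, (Nat.card {N : Submodule ℤ B // (∃ z : Bˣ, (z : B) ∈ localAt p O ∧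
        N = z • localAt p O) ∧ N.toAddSubgroup.relIndex (localAt p O).toAddSubgroup = p ^ (2 * k)} : ℝ) /
        (p : ℝ) ^ (2 * k) =
      (p : ℝ) ^ 4 / (QuotientAddGroup.mk '' (Units.val '' (MulAction.stabilizer Bˣ (localAt p O) : Set Bˣ)) :
          Set (B ⧸ (((p : ℤ) ^ 1) • localAt p O).toAddSubgroup)).ncard *
        (1 - ((QuotientAddGroup.mk '' ((localAt p O : Set B) \ ⋃ k ∈ range R,
            Units.val '' normLevelUnits p O k) :
          Set (B ⧸ (((p : ℤ) ^ R) • localAt p O).toAddSubgroup)).ncard : ℝ) / (p : ℝ) ^ (4 * R)) := by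
  classical
  -- abbreviations
  set u : ℕ := (QuotientAddGroup.mk '' (Units.val '' (MulAction.stabilizer Bˣ (localAt p O) : Set Bˣ)) :
      Set (B ⧸ (((p : ℤ) ^ 1) • localAt p O).toAddSubgroup)).ncard with hu
  set GR : ℕ := (QuotientAddGroup.mk '' (Units.val '' (MulAction.stabilizer Bˣ (localAt p O) : Set Bˣ)) :
      Set (B ⧸ (((p : ℤ) ^ R) • localAt p O).toAddSubgroup)).ncard with hGR
  set X : ℕ → ℕ := fun k => (QuotientAddGroup.mk '' (Units.val '' normLevelUnits p O k) :
      Set (B ⧸ (((p : ℤ) ^ R) • localAt p O).toAddSubgroup)).ncard with hX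
  set Y : ℕ := (QuotientAddGroup.mk '' ((localAt p O : Set B) \ ⋃ k ∈ range R,
      Units.val '' normLevelUnits p O k) : Set (B ⧸ (((p : ℤ) ^ R) • localAt p O).toAddSubgroup)).ncard
    with hY
  set a : ℕ → ℕ := fun k => Nat.card {N : Submodule ℤ B // (∃ z : Bˣ, (z : B) ∈ localAt p O ∧
      N = z • localAt p O) ∧ N.toAddSubgroup.relIndex (localAt p O).toAddSubgroup = p ^ (2 * k)} with ha
  have hpp : p.Prime := hp.out
  have hpR : (0 : ℝ) < p := by exact_mod_cast hpp.pos
  have hu0 : (0 : ℝ) < u := by exact_mod_cast hO.ncard_image_stabilizer_pos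
  -- the three identities
  have hdag : ∀ k ∈ range R, (a k : ℝ) / (p : ℝ) ^ (2 * k) = (X k : ℝ) / GR := by
    intro k hk
    have hkR : k + 1 ≤ R := Finset.mem_range.mp hk
    have h := hO.pow_mul_ncard_image_normLevel_eq (p := p) hkR
    have h' : ((p : ℝ) ^ (2 * k)) * (X k : ℝ) = (a k : ℝ) * GR := by exact_mod_cast h
    have hGR0 : (0 : ℝ) < GR := by
      have := hO.ncard_image_units_eq_pow_mul (p := p) hR
      rw [← hGR, ← hu] at this
      rw [this]; push_cast; positivity
    rw [div_eq_div_iff (pow_ne_zero _ hpR.ne') hGR0.ne', ← h', mul_comm]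
  have hred : (GR : ℝ) = (p : ℝ) ^ (4 * (R - 1)) * u := by
    have := hO.ncard_image_units_eq_pow_mul (p := p) hR
    rw [← hGR, ← hu] at this
    exact_mod_cast this
  have hpart : (p : ℝ) ^ (4 * R) = ∑ k ∈ range R, (X k : ℝ) + Y := by
    have := hO.pow_eq_sum_ncard_image_normLevel_add (p := p) R
    exact_mod_cast this
  -- assemble
  rw [Finset.sum_congr rfl hdag, ← Finset.sum_div, hred]
  have hpow : (p : ℝ) ^ (4 * R) = (p : ℝ) ^ (4 * (R - 1)) * (p : ℝ) ^ 4 := by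
    rw [← pow_add]; congr 1; omega
  have hsumX : ∑ k ∈ range R, (X k : ℝ) = (p : ℝ) ^ (4 * R) - Y := by linarith
  rw [hsumX]
  field_simp
  rw [hpow]
  ring

/-- **The local Euler factor from the unit density** (Voight Lemma 26.6.7 / §26.4 in finite
form): if the density `|Y_R mod p^R| / p^{4R}` of the norm-level complement tends to `0` as
`R → ∞`, then `∑_k a_k p^{-2k} = p⁴ / |O₍ₚ₎ˣ mod p O₍ₚ₎|`. [cite: Voight2021, Lemma 26.6.7 and §26.4] -/
theorem IsZOrder.hasSum_card_principal_div_pow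
    (hY : Tendsto (fun R : ℕ => ((QuotientAddGroup.mk '' ((localAt p O : Set B) \ ⋃ k ∈ range R,
        Units.val '' normLevelUnits p O k) :
      Set (B ⧸ (((p : ℤ) ^ R) • localAt p O).toAddSubgroup)).ncard : ℝ) / (p : ℝ) ^ (4 * R))
      atTop (𝓝 0)) :
    HasSum (fun k => (Nat.card {N : Submodule ℤ B // (∃ z : Bˣ, (z : B) ∈ localAt p O ∧
        N = z • localAt p O) ∧ N.toAddSubgroup.relIndex (localAt p O).toAddSubgroup = p ^ (2 * k)} : ℝ) /
        (p : ℝ) ^ (2 * k))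
      ((p : ℝ) ^ 4 / (QuotientAddGroup.mk '' (Units.val '' (MulAction.stabilizer Bˣ (localAt p O) : Set Bˣ)) :
          Set (B ⧸ (((p : ℤ) ^ 1) • localAt p O).toAddSubgroup)).ncard) := by
  classical
  have hpp : p.Prime := hp.out
  have hpR : (0 : ℝ) < p := by exact_mod_cast hpp.pos
  rw [hasSum_iff_tendsto_nat_of_nonneg (fun k => by positivity)]
  set C : ℝ := (p : ℝ) ^ 4 / (QuotientAddGroup.mk '' (Units.val '' (MulAction.stabilizer Bˣ
      (localAt p O) : Set Bˣ)) : Set (B ⧸ (((p : ℤ) ^ 1) • localAt p O).toAddSubgroup)).ncard with hC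
  have hlim : Tendsto (fun R : ℕ => C * (1 - ((QuotientAddGroup.mk '' ((localAt p O : Set B) \
      ⋃ k ∈ range R, Units.val '' normLevelUnits p O k) :
        Set (B ⧸ (((p : ℤ) ^ R) • localAt p O).toAddSubgroup)).ncard : ℝ) / (p : ℝ) ^ (4 * R)))
      atTop (𝓝 C) := by
    have : Tendsto (fun R : ℕ => C * (1 - ((QuotientAddGroup.mk '' ((localAt p O : Set B) \
        ⋃ k ∈ range R, Units.val '' normLevelUnits p O k) :
          Set (B ⧸ (((p : ℤ) ^ R) • localAt p O).toAddSubgroup)).ncard : ℝ) / (p : ℝ) ^ (4 * R)))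
        atTop (𝓝 (C * (1 - 0))) := (tendsto_const_nhds.sub hY).const_mul C
    simpa using this
  refine (tendsto_congr' ?_).mpr hlim
  filter_upwards [eventually_ge_atTop 1] with R hR
  rw [hC]
  exact hO.sum_range_card_principal_div_eq hR

end Literature.NumberTheory.Automorphic
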